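import Summits.BirchSwinnertonDyer.BirchSwinnertonDyer.Theses.KolyvaginDepthDoor
import Summits.BirchSwinnertonDyer.BirchSwinnertonDyer.Theorems.KolyvaginDepthDoorKolyvaginDepthSupplyDoor
import HarnessLib

/-!
# Route `KolyvaginDepthDoor` — the ASSEMBLY item (stmt-BirchSwinnertonDyer-21768)

`Assembly := KolyvaginDepthSupply → KolyvaginStructure → ShaCorankZeroAtOnePrimeOfCM →
AnalyticRankLeSelmerCorank → PadicOrderLeAnalyticRankAtOnePrime → KatoRankBound → BirchSwinnertonDyer`
is, by construction of the route (D-0027 §2.1), exactly the type of the planner's certified deciding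
theorem `closes` of `Theses/KolyvaginDepthDoor.lean` (kernel: the depth supply + Kolyvagin 1991
Thm. 4 + the PROVED Kummer identities give X1 on non-CM curves, X1 on CM curves is the crux
`ShaCorankZeroAtOnePrimeOfCM`, then KatoTransfer's two legs). This file lands it verbatim, as the
crux-attack note on the item asks (refuter-ns-typeII-critic-1, 2026-08-27T22:04Z: "TRIVIAL by the
glue … a prover lands it verbatim"). HONEST FRAMING: closing the assembly proves an IMPLICATION
whose six hypotheses are the route's items — four of them open problems (the depth supply = X1 on
non-CM curves at a surjective prime, X1 on CM curves, X2, X3) and two unproved XL literature facts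
(Kolyvagin 1991 Thm. 4, Kato 2004 Thm. 18.4); BSD is NOT proved by this, and no class theorem at
rank ≥ 2 follows.
-/

set_option linter.dupNamespace false

namespace Summit.BirchSwinnertonDyer.BirchSwinnertonDyer.Theorems

/-- **Settles the assembly item `stmt-BirchSwinnertonDyer-21768` of route `KolyvaginDepthDoor`:**
`KolyvaginDepthSupply → KolyvaginStructure → ShaCorankZeroAtOnePrimeOfCM →
AnalyticRankLeSelmerCorank → PadicOrderLeAnalyticRankAtOnePrime → KatoRankBound →
BirchSwinnertonDyer`, by the route's deciding theorem `KolyvaginDepthDoor.closes` (sorry-free,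
axioms standard). An implication only: its hypotheses are open problems / unproved named facts;
BSD is not proved. [cite: Kolyvagin1991MathAnn, §2 Thm. 4] [cite: Kato2004, Thm 18.4] -/
theorem kolyvaginDepthDoor_assembly_proof :
    Summit.BirchSwinnertonDyer.BirchSwinnertonDyer.Theses.KolyvaginDepthDoor.Assembly := by
  unfold Summit.BirchSwinnertonDyer.BirchSwinnertonDyer.Theses.KolyvaginDepthDoor.Assembly
  -- buildfix (bf3-g30, class (i) drift): the route's `closes` was re-keyed (rev ≥ 5, 2026-08-28T17:07Z) to the KN door
  -- (`KolyvaginDepthSupplyKN`, `GrossFrobeniusCongruence`, `KolyvaginDoorKN`) while `Assembly` keeps the rev-4 binders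
  -- `KolyvaginDepthSupply → KolyvaginStructure → …`; so X1 on non-CM curves is obtained here from the landed per-curve door
  -- (`KolyvaginDepthDoor.shaCorank_eq_zero_nonCM_of_weakDepthSupply` ∘ `kolyvaginDepthSupply_iff_weak`), and the rest of
  -- the deciding theorem's body (T1–T3, the two legs) is copied verbatim from the route file. Statement byte-identical.
  intro hS hF hCM hX2 hX3 hK
  have hX1 : ∀ (W : WeierstrassCurve ℚ) [W.IsElliptic] [W.IsGloballyMinimal],
      ∃ (p : ℕ) (_ : Fact p.Prime), 5 ≤ p ∧ W.HasGoodReductionAtPrime p ∧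
        ¬ (p : ℤ) ∣ W.frobeniusTrace p ∧ W.shaCorank p = 0 := by
    intro W _ _
    by_cases hcm : W.HasCM
    · exact hCM W hcm
    · exact KolyvaginDepthDoor.shaCorank_eq_zero_nonCM_of_weakDepthSupply hF
        ((KolyvaginDepthDoor.kolyvaginDepthSupply_iff_weak hF).mp hS) W hcm
  -- (T1) the Mordell–Weil rank is an isomorphism invariant (AEC III.3.1(b); `VariableChangePoints`)
  have hMW : ∀ (W : WeierstrassCurve ℚ) (C : WeierstrassCurve.VariableChange ℚ),
      (C • W).mordellWeilRank = W.mordellWeilRank := fun W C =>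
    @WeierstrassCurve.VariableChange.finrank_point_variableChange ℚ _ W C (Classical.decEq ℚ)
  -- (T2) the local Euler factor over the fraction field of a DVR is an isomorphism invariant
  have hloc : ∀ (R : Type) [CommRing R] [IsDomain R] [IsDiscreteValuationRing R]
      (K : Type) [Field K] [Algebra R K] [IsFractionRing R K]
      (W : WeierstrassCurve K) [W.IsElliptic] (C : WeierstrassCurve.VariableChange K),
      (C • W).localEulerFactor R = W.localEulerFactor R := by
    intro R _ _ _ K _ _ _ W _ C
    obtain ⟨D, hD⟩ : ∃ D : WeierstrassCurve.VariableChange K,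
        (C • W).minimal R = D • W.minimal R :=
      ⟨((C • W).exists_isMinimal R).choose * C * ((W.exists_isMinimal R).choose)⁻¹, by
        rw [WeierstrassCurve.minimal, WeierstrassCurve.minimal, mul_smul, mul_smul, inv_smul_smul]⟩
    haveI hE : (W.minimal R).IsElliptic := by rw [WeierstrassCurve.minimal]; infer_instance
    have hΔ : (W.minimal R).Δ ≠ 0 := (W.minimal R).isUnit_Δ.ne_zero
    have hgood : ((C • W).minimal R).HasGoodReduction R ↔ (W.minimal R).HasGoodReduction R := by
      rw [WeierstrassCurve.hasGoodReduction_iff, WeierstrassCurve.hasGoodReduction_iff,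
        WeierstrassCurve.valuation_Δ_eq_of_isMinimal_of_eq_smul R hD]
      exact and_congr_left' ⟨fun _ => inferInstance, fun _ => inferInstance⟩
    have hcard : Nat.card (((C • W).minimal R).reduction R).toAffine.Point =
        Nat.card ((W.minimal R).reduction R).toAffine.Point := by
      obtain ⟨E, hE⟩ := WeierstrassCurve.exists_reduction_eq_smul R hD hΔ
      rw [hE]
      exact WeierstrassCurve.natCard_point_smul _ _
    have hpoly : (C • W).localPolynomial R = W.localPolynomial R := by
      classical
      unfold WeierstrassCurve.localPolynomial
      simp only [hgood, hcard,
        WeierstrassCurve.hasSplitMultiplicativeReduction_iff_of_isMinimal_of_eq_smul R hD hΔ,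
        WeierstrassCurve.hasMultiplicativeReduction_iff_of_isMinimal_of_eq_smul R hD hΔ]
    simp only [WeierstrassCurve.localEulerFactor, WeierstrassCurve.localPowerSeries, hpoly]
  -- (T3) hence the analytic rank `ord_{s=1} L(E,s)` is an isomorphism invariant (AEC App. C §16)
  have hAn : ∀ (W : WeierstrassCurve ℚ) [W.IsElliptic] (C : WeierstrassCurve.VariableChange ℚ),
      (C • W).analyticRank = W.analyticRank := by
    intro W _ C
    have hL : (C • W).LFunction = W.LFunction := by
      unfold WeierstrassCurve.LFunction
      congr 1
      funext v
      simp only [WeierstrassCurve.baseChange, ← WeierstrassCurve.map_variableChange]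
      exact hloc _ _ _ _
    have hLS : (C • W).LSeries = W.LSeries := by
      funext s
      simp only [WeierstrassCurve.LSeries, hL]
    have hEC : (C • W).entireContinuations = W.entireContinuations := by
      simp only [WeierstrassCurve.entireContinuations, hLS]
    have hEL : (C • W).entireLFunction = W.entireLFunction := by
      unfold WeierstrassCurve.entireLFunction
      rw [hEC, hLS]
    simp only [WeierstrassCurve.analyticRank, hEL]
  -- the two legs on a global minimal model `C • W` of an arbitrary elliptic `W`
  intro W hW
  obtain ⟨C, hC⟩ := WeierstrassCurve.hasGlobalMinimalModel_rat_holds W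
  -- leg 1 (lower bound r_an ≤ r_MW): X1 at p₁, the Kummer identity, X2 at p₁
  have hLB : (C • W).analyticRank ≤ (C • W).mordellWeilRank := by
    obtain ⟨p, hp, h5, hgood, hord, hsha⟩ := hX1 (C • W)
    have hid : (C • W).selmerCorank p = (C • W).mordellWeilRank + (C • W).shaCorank p :=
      WeierstrassCurve.selmerCorank_eq_mordellWeilRank_add_holds (C • W) p
    have h2 := hX2 (C • W) p h5 hgood hord
    omega
  -- leg 2 (upper bound r_MW ≤ r_an): X3 at (p₂, f), the Kato side at (p₂, f)
  have hUB : (C • W).mordellWeilRank ≤ (C • W).analyticRank := by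
    obtain ⟨p, hp, h5, hgood, hord, N, hN, f, hf, hle⟩ := hX3 (C • W)
    have hp2 : p ≠ 2 := by omega
    have hordAt : Literature.NumberTheory.EllipticCurves.IsOrdinaryAt (C • W) p := ⟨hgood, hord⟩
    have hk := hK (C • W) p hp2 hordAt f hf
    exact_mod_cast hk.trans hle
  have h := le_antisymm hLB hUB
  rw [hAn W C, hMW W C] at h
  exact h

end Summit.BirchSwinnertonDyer.BirchSwinnertonDyer.Theorems
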